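import Literature.NumberTheory.LFunctions.Zhang2022.RepairGapLemma82Premise
import Literature.NumberTheory.LFunctions.Zhang2022.RepairGapPartIIIDoors
import Literature.NumberTheory.LFunctions.Zhang2022.SkeletonPartTwo
import HarnessLib

/-!
# Zhang (2022), rescue GAP/BED (D-0124 (3)(4)): LEMMA 8.2 — the LEAF `Skeleton.Lemma82 c′` of `theorem1_of_leaves` —
# with its guard `AssumptionA` replaced by `‖L(1,χ)‖ ≤ 𝓛⁻¹⁵` (node group 2: (8.2); GAP G-31 «main terms only E ≥ 15»)

Topic `Literature/NumberTheory/LFunctions/Zhang2022` (Landau–Siegel audit tree; verdict-neutral).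
Y. Zhang, *Discrete mean estimates and the Landau–Siegel zero*, arXiv:2211.02515v1 (2022)
[Zhang2022LandauSiegel] — **an unrefereed manuscript under adjudication; nothing in this file asserts or
denies its Theorems 1–2, and nothing here is a claim about Landau–Siegel zeros. The programme SEARCHES and
TYPES; no claim about Landau–Siegel zeros, Theorems 1–2 of arXiv:2211.02515 or a repaired Margin232 until a
kernel theorem says so.**

Lemma 8.2 (§8 p. 16: «Σ_{m<x} χ(m)m^{−(1−β_j)}(x/m)^{β_μ}log(x/m) = L′(1,χ)𝔣_{jμ}(x) + O(𝓛⁻⁶)» on `T < x < P`) is the leaf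
`Skeleton.Lemma82 c′` (a `ForAllLarge` statement guarded by `AssumptionA D χ`), a tree theorem for every `c′ ≥ 0`
(`Skeleton.lemma82_holds`, over the partial-summation core `Lemma82.lemma_8_2`). The core's minimum-premise twin is already
in the tree — `Repair.Gap.lemma82_of_norm_le_pow15` (`RepairGapLemma82Premise`, p566965; premise `‖L(1,χ)‖ ≤ 𝓛⁻¹⁵`, same
constant `C82(2(3+5c′))`). This file runs the leaf's wrapper VERBATIM over that twin: **`lemma82_pow15 : 0 ≤ c′ → (body of
Skeleton.Lemma82 c′ with AssumptionA D χ ↦ ‖L(1,χ)‖ ≤ 𝓛⁻¹⁵)`**, same constant and threshold `⌈exp(8(3+5c′)π + 3)⌉`; hence the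
leaf under `Repair.Bed.AssumptionAWith E` for every real `E ≥ 15` (`lemma82_of_assumptionAWith`); at `E = 2022` the transfer
lemma `Repair.Gap.forAllLarge_assumptionA_of_pow15` returns `Skeleton.lemma82_holds` (not restated). With
`Lemma101.lemma101_pow15` (Lemma 10.1, `RepairGapLemma101Premise`) both Part-II discrete-mean LEAVES of node group 2 that
consume (A) are kernel at E = 15 with the printed constants. Theorems only; no definition, no named fact; nothing about (A).

## References

* Y. Zhang, arXiv:2211.02515v1 (2022), §8 Lemma 8.2 (p. 16); §5 Lemma 5.8. [cite: Zhang2022LandauSiegel, §8 Lemma 8.2]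
-/

noncomputable section

open Complex Real ComplexConjugate

namespace Literature.NumberTheory.LFunctions.Zhang2022.Skeleton

open Literature.NumberTheory.LFunctions.Zhang2022.Repair.Bed (AssumptionAWith)

/-- **LEMMA 8.2 UNDER THE MINIMUM PREMISE** (twin of `Skeleton.lemma82_holds`, same constant `C82(2(3+5c′))` and
threshold): for every `c′ ≥ 0`, the body of the leaf `Skeleton.Lemma82 c′` with its guard `AssumptionA D χ` replaced by
`‖L(1,χ)‖ ≤ 𝓛⁻¹⁵` — wrapper verbatim over `Repair.Gap.lemma82_of_norm_le_pow15`. [cite: Zhang2022LandauSiegel, §8 Lemma 8.2] -/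
theorem lemma82_pow15 {c' : ℝ} (hc' : 0 ≤ c') :
    ∃ C : ℝ, ForAllLarge fun D _ χ => ‖χ.LFunction 1‖ ≤ 1 / Real.log D ^ 15 →
    ∀ j ∈ ({1, 2, 3} : Finset ℕ), ∀ μ ∈ ({6, 7} : Finset ℕ), ∀ y : ℝ, bigT D < y → y < bigP D →
      ‖(∑ m ∈ Finset.Ico 1 ⌈y⌉₊, χ (m : ZMod D) / (m : ℂ) ^ (1 - betaJ c' D j) *
            ((y / m : ℝ) : ℂ) ^ betaMu D μ * (Real.log (y / m) : ℂ)) -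
          deriv χ.LFunction 1 * frakfW c' D j μ y‖ ≤ C * (ell D ^ 6)⁻¹ := by
  obtain ⟨C, h⟩ := Repair.Gap.lemma82_of_norm_le_pow15 hc'
  refine ⟨C, ⌈Real.exp (8 * (3 + 5 * c') * π + 3)⌉₊,
    fun D _ χ hD hq hp h15 j hj μ hμ y hTy hyP => ?_⟩
  have hexp : Real.exp (8 * (3 + 5 * c') * π + 3) ≤ D :=
    le_trans (Nat.le_ceil _) (by exact_mod_cast hD)
  have hlog : 8 * (3 + 5 * c') * π + 3 ≤ Real.log D :=
    (Real.le_log_iff_exp_le (lt_of_lt_of_le (Real.exp_pos _) hexp)).mpr hexp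
  have hπ0 : 0 ≤ 8 * (3 + 5 * c') * π := by positivity
  have hL3 : 3 ≤ Real.log D := by linarith
  have hL8 : 8 * (3 + 5 * c') * π ≤ Real.log D ^ 8 := by
    have h1 : (1 : ℝ) ≤ Real.log D := by linarith
    calc 8 * (3 + 5 * c') * π ≤ Real.log D := by linarith
      _ = Real.log D ^ 1 := (pow_one _).symm
      _ ≤ Real.log D ^ 8 := pow_le_pow_right₀ h1 (by norm_num)
  have hα : alpha D = π / Real.log D ^ 9 := by rw [alpha, bigP, Real.log_exp, ell]
  have hβj : betaJ c' D j ∈ ({Lemma82.beta1 c' (Real.log D), Lemma82.beta2 c' (Real.log D),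
      Lemma82.beta3 c' (Real.log D)} : Set ℂ) := by
    simp only [Finset.mem_insert, Finset.mem_singleton] at hj
    simp only [Set.mem_insert_iff, Set.mem_singleton_iff]
    rcases hj with rfl | rfl | rfl
    · left
      simp only [betaJ, Nat.reduceMod, if_true, beta1, Lemma82.beta1, hα, ell]
      push_cast; ring
    · right; left
      simp only [betaJ, Nat.reduceMod, beta2, Lemma82.beta2, hα, ell]
      norm_num; ring
    · right; right
      simp only [betaJ, Nat.reduceMod, beta3, Lemma82.beta3, hα, ell]
      norm_num; ring
  have hβμ : betaMu D μ ∈ ({betaMain (3 / 2) (π / Real.log D ^ 9),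
      betaMain (5 / 2) (π / Real.log D ^ 9)} : Set ℂ) := by
    simp only [Finset.mem_insert, Finset.mem_singleton] at hμ
    simp only [Set.mem_insert_iff, Set.mem_singleton_iff]
    rcases hμ with rfl | rfl
    · left
      simp only [betaMu, beta6, betaMain, hα]
      norm_num; ring
    · right
      simp only [betaMu, if_true, beta7, betaMain, hα]
      push_cast; ring
  have hy1 : Real.exp (Real.log D ^ (11 / 10 : ℝ)) ≤ y := by
    have : bigT D = Real.exp (Real.log D ^ (11 / 10 : ℝ)) := by rw [bigT, ell]; norm_num
    rw [← this]; exact hTy.le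
  have hy2 : y ≤ Real.exp (Real.log D ^ 9) := by
    have : bigP D = Real.exp (Real.log D ^ 9) := by rw [bigP, ell]
    rw [← this]; exact hyP.le
  have hy0 : 0 < y := lt_of_lt_of_le (Real.exp_pos _) hy1
  have key := h D χ hp hL3 h15 hL8 (betaJ c' D j) hβj (betaMu D μ) hβμ y hy1 hy2
  rw [frakfW, sum82_eq χ _ _ hy0, ← div_eq_mul_inv]
  exact key

/-- **Lemma 8.2 from Assumption (A) with ANY exponent `E ≥ 15`** (`Repair.Bed.AssumptionAWith E`; printed `E = 2022`,
under which the transfer lemma returns the tree leaf `Skeleton.lemma82_holds`). [cite: Zhang2022LandauSiegel, §8 Lemma 8.2] -/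
theorem lemma82_of_assumptionAWith {c' : ℝ} (hc' : 0 ≤ c') {E : ℝ} (hE : 15 ≤ E) :
    ∃ C : ℝ, ForAllLarge fun D _ χ => AssumptionAWith E D χ →
    ∀ j ∈ ({1, 2, 3} : Finset ℕ), ∀ μ ∈ ({6, 7} : Finset ℕ), ∀ y : ℝ, bigT D < y → y < bigP D →
      ‖(∑ m ∈ Finset.Ico 1 ⌈y⌉₊, χ (m : ZMod D) / (m : ℂ) ^ (1 - betaJ c' D j) *
            ((y / m : ℝ) : ℂ) ^ betaMu D μ * (Real.log (y / m) : ℂ)) -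
          deriv χ.LFunction 1 * frakfW c' D j μ y‖ ≤ C * (ell D ^ 6)⁻¹ := by
  obtain ⟨C, h⟩ := lemma82_pow15 hc'
  exact ⟨C, Repair.Gap.forAllLarge_assumptionAWith_of_pow15 hE h⟩

end Literature.NumberTheory.LFunctions.Zhang2022.Skeleton
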